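import Mathlib
import Summits.Ventures.PercRepro2.SwOutCrossGenProdNC

/-!
# The product of two dropped components: transfer and iteration (blind cell PercRepro2, night-4
g24, 2026-08-28; proofs/NIGHT4-G24.md §11)

The product cube of `SwOutCrossGenProdDefs` is the cube of `FibreIter.prod` (`LeakI_prod`,
`ERI_prod`, `EBI_prod`, `QI_prod`), so the inequality of the product follows from that of the
first factor (`ineq_prod`).  A list of **steps** — an extra dropped vertex (`Step.bit`) or a
further component (`Step.comp`) — is folded into one `FibreIter` (`FibreIter.steps`), whose
inequality holds whenever the starting fibre's does (`ineq_steps`).  **`card_le_crossKEESteps`**: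
the abstract theorem of boundary (iv) at one junction for any number of connected cross
components and any number of extra dropped vertices.
-/

namespace Summit.Ventures.PercRepro2

namespace CrossArm

section Transfer

variable {W₁ A₁ L₁ W₂ A₂ L₂ : Type*} {ι : Type*} (F₁ : FibreIter W₁ A₁ L₁) (F₂ : FibreDataBit W₂ A₂ L₂)

/-- The leak of the product fibre is the product leak. -/
lemma LeakI_prod (x : PtP W₁ W₂ ι) : LeakI (F₁.prod F₂) x ↔ LeakP F₁ F₂ x := by
  obtain ⟨s, w₁, w₂⟩ := x
  simp only [LeakI, LeakP, FibreIter.prod, Bool.or_eq_true]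
  tauto

/-- The red atoms of the product fibre are the product red atoms. -/
lemma ERI_prod (x : PtP W₁ W₂ ι) : ERI (F₁.prod F₂) x = ERP F₁ F₂ x := by
  ext a
  rcases a with j | (u | (a | a))
  · show x.1 j = true ↔ _
    rw [ERP, Set.mem_union]
    constructor
    · intro h
      exact Or.inl ((liftA₁_mem_image_iff _ (Sum.inl j)).2 h)
    · rintro (h | ⟨a, ha, -⟩)
      · exact (liftA₁_mem_image_iff _ (Sum.inl j)).1 h
      · exact absurd ha (by simp [atomA₂])
  · show redUG x.1 ↔ _
    rw [ERP, Set.mem_union]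
    constructor
    · intro h
      exact Or.inl ((liftA₁_mem_image_iff _ (Sum.inr (Sum.inl u))).2 h)
    · rintro (h | ⟨a, ha, -⟩)
      · exact (liftA₁_mem_image_iff _ (Sum.inr (Sum.inl u))).1 h
      · exact absurd ha (by simp [atomA₂])
  · show redUG x.1 ∧ F₁.red x.2.1 a = true ↔ _
    rw [ERP, Set.mem_union]
    constructor
    · intro h
      exact Or.inl ((liftA₁_mem_image_iff _ (Sum.inr (Sum.inr a))).2 h)
    · rintro (h | ⟨a', ha, -⟩)
      · exact (liftA₁_mem_image_iff _ (Sum.inr (Sum.inr a))).1 h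
      · exact absurd ha (by simp [atomA₂])
  · show redUG x.1 ∧ F₂.red x.2.2 a = true ↔ _
    rw [ERP, Set.mem_union]
    constructor
    · intro h
      exact Or.inr ⟨a, rfl, h.1, h.2⟩
    · rintro (h | ⟨a', ha, hs, hr⟩)
      · exact absurd h (atomA₂_notMem_lift _ a)
      · have : a' = a := by simpa [atomA₂] using ha.symm
        subst this
        exact ⟨hs, hr⟩

/-- The blue atoms of the product fibre are the product blue atoms. -/
lemma EBI_prod (x : PtP W₁ W₂ ι) : EBI (F₁.prod F₂) x = EBP F₁ F₂ x := by
  show ERI (F₁.prod F₂) (flipI (F₁.prod F₂) x) = ERP F₁ F₂ (flipP F₁ F₂ x)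
  rw [ERI_prod]
  rfl

/-- The up-sets of types of the product fibre are the product up-sets. -/
lemma isUpP_of_isUpI {𝒯 : Set (TypP L₁ L₂ ι)} (h : IsUpI (F₁.prod F₂) 𝒯) : IsUpP F₁ F₂ 𝒯 :=
  fun t ht t' hle => h t ht t' hle

variable [Fintype ι] [DecidableEq ι] [Fintype W₁] [DecidableEq W₁] [Fintype W₂] [DecidableEq W₂]

open scoped Classical

omit [DecidableEq W₁] [DecidableEq W₂] in
/-- The non-leaking points of the product fibre are those of the product cube. -/
lemma QI_prod (𝒯 : Set (TypP L₁ L₂ ι)) : QI (F₁.prod F₂) 𝒯 = QP F₁ F₂ 𝒯 := by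
  ext x
  rw [mem_QI, mem_QP, LeakI_prod]
  rfl

variable [Nonempty ι]

omit [DecidableEq W₁] [DecidableEq W₂] in
/-- **The inequality of the product.** -/
theorem ineq_prod (hineq : Ineq F₁ (ι := ι)) : Ineq (F₁.prod F₂) (ι := ι) := by
  intro 𝒯 𝓔 h𝒯 h𝓔
  have e1 : ((QI (F₁.prod F₂) 𝒯).filter fun q => ERI (F₁.prod F₂) q ∈ 𝓔) =
      (QP F₁ F₂ 𝒯).filter fun x => ERP F₁ F₂ x ∈ 𝓔 := by
    rw [QI_prod]
    exact Finset.filter_congr fun x _ => by rw [ERI_prod]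
  have e2 : ((QI (F₁.prod F₂) 𝒯).filter fun q => EBI (F₁.prod F₂) q ∈ 𝓔) =
      (QP F₁ F₂ 𝒯).filter fun x => EBP F₁ F₂ x ∈ 𝓔 := by
    rw [QI_prod]
    exact Finset.filter_congr fun x _ => by rw [EBI_prod]
  rw [e1, e2]
  exact ineq_prod_aux F₁ F₂ hineq (isUpP_of_isUpI F₁ F₂ h𝒯) h𝓔

end Transfer

section Steps

universe u

/-- A component to be multiplied in: its fibre data with the injection `theta`, on a finite
type with decidable equality. -/
structure Comp : Type (u + 1) where
  /-- the fibre points -/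
  W : Type u
  /-- the atoms -/
  A : Type u
  /-- the labels -/
  L : Type u
  /-- the fibre data -/
  F : FibreDataBit W A L
  /-- finiteness of the fibre points -/
  [fW : Fintype W]
  /-- decidable equality of the fibre points -/
  [dW : DecidableEq W]

/-- A step of the construction: an extra dropped vertex, or a further component. -/
inductive Step : Type (u + 1)
  /-- an extra dropped vertex -/
  | bit : Step
  /-- a further component -/
  | comp (c : Comp.{u}) : Step

/-- The fibre points after a list of steps. -/
def stepsW (W : Type u) : List Step.{u} → Type u
  | [] => W
  | Step.bit :: l => stepsW W l × (Bool × Bool)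
  | Step.comp c :: l => stepsW W l × c.W

/-- The atoms after a list of steps. -/
def stepsA (A : Type u) : List Step.{u} → Type u
  | [] => A
  | Step.bit :: l => stepsA A l ⊕ Unit
  | Step.comp c :: l => stepsA A l ⊕ c.A

/-- The labels after a list of steps. -/
def stepsL (L : Type u) : List Step.{u} → Type u
  | [] => L
  | Step.bit :: l => stepsL L l × Bool
  | Step.comp c :: l => stepsL L l × c.L

/-- The fibre after a list of steps. -/
def FibreIter.steps {W A L : Type u} (F : FibreIter W A L) :
    ∀ l : List Step.{u}, FibreIter (stepsW W l) (stepsA A l) (stepsL L l)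
  | [] => F
  | Step.bit :: l => (F.steps l).bit
  | Step.comp c :: l => (F.steps l).prod c.F

/-- `stepsW W l` is finite when `W` is. -/
instance instFintypeStepsW (W : Type u) [Fintype W] : ∀ l : List Step.{u}, Fintype (stepsW W l)
  | [] => inferInstanceAs (Fintype W)
  | Step.bit :: l => @instFintypeProd _ _ (instFintypeStepsW W l) inferInstance
  | Step.comp c :: l => @instFintypeProd _ _ (instFintypeStepsW W l) c.fW

/-- `stepsW W l` has decidable equality when `W` has. -/
instance instDecidableEqStepsW (W : Type u) [DecidableEq W] :
    ∀ l : List Step.{u}, DecidableEq (stepsW W l)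
  | [] => inferInstanceAs (DecidableEq W)
  | Step.bit :: l => @instDecidableEqProd _ _ (instDecidableEqStepsW W l) inferInstance
  | Step.comp c :: l => @instDecidableEqProd _ _ (instDecidableEqStepsW W l) c.dW

variable {W A L : Type u} {ι : Type*} [Fintype ι] [DecidableEq ι] [Nonempty ι] [Fintype W]
  [DecidableEq W]

/-- **The inequality after any list of steps.** -/
theorem ineq_steps (F : FibreIter W A L) (hineq : Ineq F (ι := ι)) :
    ∀ l : List Step.{u}, Ineq (F.steps l) (ι := ι)
  | [] => hineq
  | Step.bit :: l => ineq_bit (F.steps l) (ineq_steps F hineq l)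
  | Step.comp c :: l =>
    letI := c.fW
    letI := c.dW
    ineq_prod (F.steps l) c.F (ineq_steps F hineq l)

end Steps

section Cross

universe u

variable {V : Type u} (G : SimpleGraph V) [Fintype V] [DecidableEq V] [DecidableRel G.Adj]
  [Nonempty V] (hG : G.Connected)

/-- The component of a connected cross graph. -/
noncomputable def compKEE : Comp.{u} where
  W := FibKE V G
  A := AtomKEE V G
  L := LabelKE V
  F := fibKEEBit G hG

variable {ι : Type*} [Fintype ι] [DecidableEq ι] [Nonempty ι]

/-- **THE ABSTRACT THEOREM OF BOUNDARY (iv) AT ONE JUNCTION FOR ANY NUMBER OF CONNECTED CROSS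
COMPONENTS AND ANY NUMBER OF EXTRA DROPPED VERTICES**: the steps `Step.comp (compKEE G' hG')`
add a further connected cross component, the steps `Step.bit` a further dropped vertex. -/
theorem card_le_crossKEESteps (l : List Step.{u}) :
    Ineq ((FibreIter.ofBit (fibKEEBit G hG)).steps l) (ι := ι) :=
  ineq_steps _ (ineq_ofBit (fibKEEBit G hG)) l

open scoped Classical in
/-- **Two connected cross components at one junction, in unfolded form**: on every up-set of
product types, the red count is at most the blue count for every up-set of atom sets. -/
theorem card_le_crossKEEProd {V' : Type*} (G' : SimpleGraph V') [Fintype V'] [DecidableEq V']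
    [DecidableRel G'.Adj] [Nonempty V'] (hG' : G'.Connected)
    {𝒯 : Set (TypP (LabelKE V) (LabelKE V') ι)}
    (h𝒯 : IsUpP (FibreIter.ofBit (fibKEEBit G hG)) (fibKEEBit G' hG') 𝒯)
    {𝓔 : Set (Set (AtomPr (AtomKEE V G) (AtomKEE V' G') ι))} (h𝓔 : IsUpperSet 𝓔) :
    ((QP (FibreIter.ofBit (fibKEEBit G hG)) (fibKEEBit G' hG') 𝒯).filter fun x =>
        ERP (FibreIter.ofBit (fibKEEBit G hG)) (fibKEEBit G' hG') x ∈ 𝓔).card ≤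
      ((QP (FibreIter.ofBit (fibKEEBit G hG)) (fibKEEBit G' hG') 𝒯).filter fun x =>
        EBP (FibreIter.ofBit (fibKEEBit G hG)) (fibKEEBit G' hG') x ∈ 𝓔).card :=
  ineq_prod_aux _ _ (ineq_ofBit (fibKEEBit G hG)) h𝒯 h𝓔

end Cross

end CrossArm

end Summit.Ventures.PercRepro2
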